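import Literature.Computability.QuantumComplexity.ApproxBosonSamplingAccounting
import Literature.Computability.Complexity.CountingProofs
import Literature.Computability.Complexity.OracleClosure
import HarnessLib

/-!
# Approximate BosonSampling: machine-side facts of Aaronson–Arkhipov's proof of Thm. 1.3, I

Family `quantum-advantage`; companion to `ApproxBosonSamplingAccounting.lean` and
`ApproxBosonSamplingIdealSide.lean` (S. Aaronson, A. Arkhipov, *The computational complexity of
linear optics*, Theory of Computing 9 (2013) 143–252 (AA13), proof of Thm. 1.3, §5.2). The
`FBPP^{NP^𝒪}` machine of that proof applies Stockmeyer's approximate counting (Thm. 4.1, in the tree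
`stockmeyerApproxCounting : ∀ O R, R ∈ P^O → …`) to the Boolean function
`r ↦ [𝒪(A, 0^{1/β}, r) = S*]` (eq. (5.80), p. 193) — i.e. to the coin predicate
`samplerRel (oracleRandAlg 𝒪 c)` of the coin-taking oracle read as a classical sampler
(`ApproxBosonSamplingAccounting.lean`). This file supplies the hypothesis of Thm. 4.1 there:

* `mem_PRel_of_oneQuery` — one query to a *function* oracle followed by a `P` test decides a
  `P^O` language (the string-oracle form of `PPSharpP.mem_PRel_ofFun_of_oneQuery`);
* `setOf_mem_P_mem_PRel_of_mem_FPRel` — preimages of `P` languages under `FP^O` maps are in `P^O`;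
* `setOf_apply_eq_apply_mem_PRel` — equality tests `{w | F w = G w}` of `F ∈ FP^O` against
  `G ∈ FP` are in `P^O` (relativised `setOf_apply_eq_apply_mem_P`);
* **`samplerRel_oracleRandAlg_mem_PRel`** — the coin predicate
  `{⟨⟨x, y⟩, r⟩ | 𝒪(⟨x, r⟩) = y}` of a coin-taking oracle is in `P^𝒪` (two pairing projections, one
  oracle query, one string comparison), so that `stockmeyerApproxCounting 𝒪 (samplerRel …)` yields
  the `NP^𝒪` language and the `FP^{NP^𝒪}` counter used at eq. (5.89).

All proved from the tree's oracle-machine toolkit (`self_mem_FPRel`, `postPre_mem_FPRel`,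
`OracleAlg.PRel_subset_PRel_of_mem_FPRel`, `TTClosure.ttAlg`, `EqPair_mem_P`); no new facts.

## References

* S. Aaronson, A. Arkhipov, *The computational complexity of linear optics*, Theory of Computing 9
  (2013) 143–252: proof of Thm. 1.3, eqs. (5.80), (5.89) (pp. 193–194); Thm. 4.1 (p. 175).
* S. Arora, B. Barak, *Computational Complexity: A Modern Approach*, CUP 2009, §3.4 (oracle
  machines, Example 3.6 (2)), §1.3 (string equality in `P`).
-/

open Computability Polynomial Literature.Computability.Cryptography Literature.Computability.Complexity
  Literature.Computability.Complexity.TTClosure Literature.Computability.Complexity.PPSharpP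

namespace Literature.Computability.QuantumComplexity

/-! ### One-query `P^O` languages and relativised equality tests -/

/-- **One function-oracle query plus a `P` post-processing**: if `D ∈ P` and
`x ∈ L ↔ ⟨x, O x⟩ ∈ D` for every `x`, then `L ∈ P^O`, by the oracle algorithm `ttAlg fstP 1 D`
(ask `x`, test the pair of input and answer) with the budget `|x| + 2`. The string-oracle form of
`PPSharpP.mem_PRel_ofFun_of_oneQuery`. [cite: AroraBarak2009, §3.4 (Def. 3.4, Example 3.6)] -/
theorem mem_PRel_of_oneQuery {L D : Language Bool} (hD : D ∈ Classes.P) (O : Oracle)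
    (h : ∀ x, x ∈ L ↔ boolPair x (O x) ∈ D) : L ∈ PRel O := by
  refine ⟨ttAlg fstP 1 D, isPolyTime_ttAlg fstP_mem_FP hD, X + 2, fun x => ⟨?_, ?_⟩⟩
  · rw [eval_add, eval_X, show (2 : Polynomial ℕ).eval x.length = 2 by simp, run_ttAlg_one]
    congr 1
    by_cases hx : x ∈ L
    · rw [(Set.mem_iff_boolIndicator _ _).1 hx, (Set.mem_iff_boolIndicator _ _).1 ((h x).1 hx)]
    · rw [(Set.notMem_iff_boolIndicator _ _).1 hx,
        (Set.notMem_iff_boolIndicator _ _).1 (fun hD' => hx ((h x).2 hD'))]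
  · intro y hy
    rw [queries_ttAlg_one D _ x _ y hy]
    simp

/-- **Preimages of `P` languages under `FP^O` maps are in `P^O`**: for `g ∈ FP^O` and `D ∈ P`,
`{w | g w ∈ D} ∈ P^{g} ⊆ P^O` (one query to the function oracle `g` and a `P` test, then
`P^{FP^O} = P^O`, `OracleAlg.PRel_subset_PRel_of_mem_FPRel`). [cite: AroraBarak2009, §3.4 Example 3.6 (2) with Remark 3.8] -/
theorem setOf_mem_P_mem_PRel_of_mem_FPRel {O : Oracle} {g : List Bool → List Bool}
    (hg : g ∈ FPRel O) {D : Language Bool} (hD : D ∈ Classes.P) :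
    ({w | g w ∈ D} : Language Bool) ∈ PRel O := by
  refine OracleAlg.PRel_subset_PRel_of_mem_FPRel hg ?_
  have hD' : ({z | (boolUnpair z).2 ∈ D} : Language Bool) ∈ Classes.P :=
    preimage_mem_P hD boolUnpairSnd_mem_FP
  refine mem_PRel_of_oneQuery hD' g fun x => ?_
  change g x ∈ D ↔ (boolUnpair (boolPair x (g x))).2 ∈ D
  rw [boolUnpair_boolPair]

/-- **Relativised equality tests**: for `F ∈ FP^O` and `G ∈ FP` the language `{w | F w = G w}` is
in `P^O` — the preimage of `EqPair` under `w ↦ ⟨F w, G w⟩ ∈ FP^O` (`postPre_mem_FPRel` with the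
identity pre-processing and the fan-out post-processing `⟨w, a⟩ ↦ ⟨a, G w⟩`).
[cite: AroraBarak2009, §3.4 Example 3.6 (2) with §1.3] -/
theorem setOf_apply_eq_apply_mem_PRel {O : Oracle} {F G : List Bool → List Bool} (hF : F ∈ FPRel O)
    (hG : G ∈ FP) : ({w | F w = G w} : Language Bool) ∈ PRel O := by
  have hpost : fanoutFn (fun z : List Bool => (boolUnpair z).2) (G ∘ fun z : List Bool => (boolUnpair z).1)
      ∈ FP :=
    fanoutFn_mem_FP boolUnpairSnd_mem_FP (comp_mem_FP hG boolUnpairFst_mem_FP)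
  have hh0 := postPre_mem_FPRel hF (PolyTimeComputable.id _) hpost
  have hh : (fun w => boolPair (F w) (G w)) ∈ FPRel O := by
    convert hh0 using 1
    funext w
    simp [fanoutFn_apply]
  have hset : ({w | F w = G w} : Language Bool) = {w | boolPair (F w) (G w) ∈ EqPair} := by
    ext w
    change F w = G w ↔ boolPair (F w) (G w) ∈ EqPair
    rw [boolPair_mem_EqPair]
  rw [hset]
  exact setOf_mem_P_mem_PRel_of_mem_FPRel hh EqPair_mem_P

/-! ### The coin predicate of a coin-taking oracle is in `P^𝒪` (hypothesis of Thm. 4.1 at eq. (5.80)) -/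

/-- **`samplerRel (oracleRandAlg 𝒪 c) ∈ P^𝒪`.** The relation counted at eqs. (5.80)/(5.89) —
`⟨⟨x, y⟩, r⟩ ↦ [𝒪(⟨x, r⟩) = y]`, "`q_{S*} = Pr_r[𝒪(A, 0^{1/β}, r) = S*]` … can be approximated in
`FBPP^{NP^𝒪}` using Stockmeyer's approximate counting method (Theorem 4.1)" (p. 193) — is decided
relative to `𝒪` by two pairing projections, one query `⟨x, r⟩` and a string comparison: it is the
equality test of `F = 𝒪 ∘ (w ↦ ⟨x, r⟩) ∈ FP^𝒪` (`self_mem_FPRel`, `comp_FP_mem_FPRel`) against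
`G = (w ↦ y) ∈ FP`. Feeding it to `stockmeyerApproxCounting` gives the `NP^𝒪` language and the
`FP^{NP^𝒪}` counter of the proof of Thm. 1.3. [cite: AaronsonArkhipovToC2013, proof of Thm. 1.3, eq. (5.80) (p. 193) with Thm. 4.1 (p. 175)] -/
theorem samplerRel_oracleRandAlg_mem_PRel (O : Oracle) (c : Polynomial ℕ) :
    samplerRel (oracleRandAlg O c) ∈ PRel O := by
  have hfst : (fun z : List Bool => (boolUnpair z).1) ∈ FP := boolUnpairFst_mem_FP
  have hsnd : (fun z : List Bool => (boolUnpair z).2) ∈ FP := boolUnpairSnd_mem_FP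
  have hpre : fanoutFn ((fun z : List Bool => (boolUnpair z).1) ∘ fun z : List Bool => (boolUnpair z).1)
      (fun z : List Bool => (boolUnpair z).2) ∈ FP :=
    fanoutFn_mem_FP (comp_mem_FP hfst hfst) hsnd
  have hF : (O ∘ fanoutFn ((fun z : List Bool => (boolUnpair z).1) ∘ fun z : List Bool => (boolUnpair z).1)
      (fun z : List Bool => (boolUnpair z).2)) ∈ FPRel O :=
    comp_FP_mem_FPRel (self_mem_FPRel O) hpre
  have hG : ((fun z : List Bool => (boolUnpair z).2) ∘ fun z : List Bool => (boolUnpair z).1) ∈ FP :=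
    comp_mem_FP hsnd hfst
  have hEq : samplerRel (oracleRandAlg O c) =
      {w | (O ∘ fanoutFn ((fun z : List Bool => (boolUnpair z).1) ∘ fun z : List Bool =>
          (boolUnpair z).1) (fun z : List Bool => (boolUnpair z).2)) w =
        ((fun z : List Bool => (boolUnpair z).2) ∘ fun z : List Bool => (boolUnpair z).1) w} := by
    ext w
    simp only [samplerRel, Function.comp_apply, fanoutFn_apply, oracleRandAlg_run]
  rw [hEq]
  exact setOf_apply_eq_apply_mem_PRel hF hG

/-- **Hence Stockmeyer counting applies to it**: from `stockmeyerApproxCounting` (Thm. 4.1,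
relativised; proved in `StockmeyerMachines.lean`) one obtains a language `L ∈ NP^𝒪`, a counter
`F ∈ FP^L` and a coin polynomial `cS` estimating `#{r | 𝒪(⟨x', r⟩) = y}` to within every factor
`1 + 1/kη` except on a `≤ 1/kδ` fraction of its coins — the estimate `q̃_{S*}` of eq. (5.89).
[cite: AaronsonArkhipovToC2013, proof of Thm. 1.3, eq. (5.89) (p. 194) with Thm. 4.1 (p. 175)] -/
theorem exists_stockmeyer_counter_samplerRel (hStock : stockmeyerApproxCounting) (O : Oracle)
    (c : Polynomial ℕ) :
    ∃ L ∈ NPRel O, ∃ F ∈ FPRel (Oracle.ofLanguage L), ∃ cS : Polynomial ℕ,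
      ∀ (x : List Bool) (m kη kδ : ℕ), 0 < kη → 0 < kδ →
        uniformProb (cS.eval (x.length + m + kη + kδ))
            {u | ¬ IsApproxCount kη (countWitnesses (samplerRel (oracleRandAlg O c)) m x)
              (countEstimate F x m kη kδ u)} ≤ 1 / (kδ : ℝ) :=
  hStock O _ (samplerRel_oracleRandAlg_mem_PRel O c)

end Literature.Computability.QuantumComplexity
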